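import Mathlib
import Summits.Ventures.PercRepro2.K5StarGenParts

/-!
# THE GENERAL-STAR CERTIFICATES, VI′: THE PARTS UP TO A PERMUTATION
(blind cell PercRepro2, mine-2 g41, 2026-08-29; `proofs/MINE2-GENSTAR.md` §4)

The parts found by the orbit search are subsets of the alive placements, not contiguous pieces of the
list: the masked-count sum is invariant under permutations of the list (`msum_perm`), so the
concatenation of the parts need only be a PERMUTATION of the alive list (decided by `List.isPerm`):
**`starNonnegGen_of_parts'`**, and its forms on the nested lazy products at the three markings
(**`starNonnegGen_of_partsM4 / M3 / M0`**).  Own code; standard axioms.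
-/

namespace Summit.Ventures.PercRepro2

open Hub

namespace K5

section PartsPerm

variable {R : Type*} [Field R]

/-- `msum` is the sum of the masked counts over the list. -/
lemma msum_eq_sum (F : Finset (Fin 10)) (z : Config (Fin 10)) (τ : Fin 10 → ℕ)
    (K : Config (Fin 10) → Config (Fin 10) → Config (Fin 10) → R) :
    ∀ ms : List Mask3, msum F z τ K ms = (ms.map fun t => mcount F z τ t.1 t.2.1 t.2.2 K).sum
  | [] => by simp [msum]
  | t :: ms => by rw [msum, List.map_cons, List.sum_cons, msum_eq_sum F z τ K ms]

/-- `msum` is invariant under permutations of the list. -/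
lemma msum_perm (F : Finset (Fin 10)) (z : Config (Fin 10)) (τ : Fin 10 → ℕ)
    (K : Config (Fin 10) → Config (Fin 10) → Config (Fin 10) → R) {l l' : List Mask3} (h : l.Perm l') :
    msum F z τ K l = msum F z τ K l' := by
  rw [msum_eq_sum, msum_eq_sum]
  exact (h.map _).sum_eq

variable [LinearOrder R] [IsStrictOrderedRing R]

/-- **`StarNonnegGen` from the certificates of the parts**, the parts a permutation of the alive placements. -/
theorem starNonnegGen_of_parts' (n : ℕ) (b : Fin 5) (hb : (b : ℕ) = n) (L : List (Fin 5 × ℕ))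
    (parts : List (List Mask3)) (hms : (((placeList L ∅ ∅ ∅).map cmask3).filter alive).Perm (concatL parts))
    (hc : ∀ p ∈ parts, p.length ≤ 454 ∧ CertLE8 (sumL (negOn38sw n) p) (sumL (posOn38sw n) p)) :
    StarNonnegGen R 0 1 2 3 b L := by
  intro F τ _
  rw [placeSum_eq_msum, msum_eq_msum_alive, msum_perm F _ τ _ hms]
  exact msum_nonneg_of_digits n b hb _ (cSumL_neg_le_pos_of_parts n parts hc) F τ

/-- The parts' certificates at `b = 4` on the nested lazy products. -/
theorem starNonnegGen_of_partsM4 (L : List (Fin 5 × ℕ)) (parts : List (List Mask3))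
    (partsI : List (List (ℕ × ℕ × ℕ)))
    (hms : (((placeList L ∅ ∅ ∅).map cmask3).filter alive).Perm (concatL parts))
    (hI : parts.map (fun p => p.map swIdx) = partsI) (hlen : ∀ p ∈ parts, p.length ≤ 454)
    (hc : ∀ q ∈ partsI, CertLE8 (sumLI negOn38M4 q) (sumLI posOn38M4 q)) :
    StarNonnegGen R 0 1 2 3 4 L := by
  refine starNonnegGen_of_parts' 4 4 rfl L parts hms fun p hp => ⟨hlen p hp, ?_⟩
  refine part_cert4 p (p.map swIdx) rfl (hc _ ?_)
  rw [← hI]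
  exact List.mem_map_of_mem hp

/-- The parts' certificates at `b = 3` on the nested lazy products. -/
theorem starNonnegGen_of_partsM3 (L : List (Fin 5 × ℕ)) (parts : List (List Mask3))
    (partsI : List (List (ℕ × ℕ × ℕ)))
    (hms : (((placeList L ∅ ∅ ∅).map cmask3).filter alive).Perm (concatL parts))
    (hI : parts.map (fun p => p.map swIdx) = partsI) (hlen : ∀ p ∈ parts, p.length ≤ 454)
    (hc : ∀ q ∈ partsI, CertLE8 (sumLI negOn38M3 q) (sumLI posOn38M3 q)) :
    StarNonnegGen R 0 1 2 3 3 L := by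
  refine starNonnegGen_of_parts' 3 3 rfl L parts hms fun p hp => ⟨hlen p hp, ?_⟩
  refine part_cert3 p (p.map swIdx) rfl (hc _ ?_)
  rw [← hI]
  exact List.mem_map_of_mem hp

/-- The parts' certificates at `b = 0` on the nested lazy products. -/
theorem starNonnegGen_of_partsM0 (L : List (Fin 5 × ℕ)) (parts : List (List Mask3))
    (partsI : List (List (ℕ × ℕ × ℕ)))
    (hms : (((placeList L ∅ ∅ ∅).map cmask3).filter alive).Perm (concatL parts))
    (hI : parts.map (fun p => p.map swIdx) = partsI) (hlen : ∀ p ∈ parts, p.length ≤ 454)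
    (hc : ∀ q ∈ partsI, CertLE8 (sumLI negOn38M0 q) (sumLI posOn38M0 q)) :
    StarNonnegGen R 0 1 2 3 0 L := by
  refine starNonnegGen_of_parts' 0 0 rfl L parts hms fun p hp => ⟨hlen p hp, ?_⟩
  refine part_cert0 p (p.map swIdx) rfl (hc _ ?_)
  rw [← hI]
  exact List.mem_map_of_mem hp

end PartsPerm

end K5

end Summit.Ventures.PercRepro2
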